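import Mathlib
import Literature.Analysis.FluidPDE.AxisymNoSwirlVorticity
import Literature.Analysis.FluidPDE.LeraySelfSimilarCalculus
import Summits.NavierStokesRegularity.NavierStokesRegularity.Theorems.FilamentSkeletonRssKelvinGateTools

/-!
# Route `FilamentSkeletonRss` · crux `TransverseReductionRJ` (stmt-NavierStokesRegularity-21221) — line `kelvin_gate`,
# stub S2′ `EventualKelvinGate`: the ROTATION–DILATION conjugation behind the free gate

Helper file (theorems only, `--supports stmt-NavierStokesRegularity-21221 --as helper`).  HONEST FRAMING:
analysis bookkeeping for a HYPOTHETICAL filament-type rotating-self-similar blow-up route; nothing here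
bears on Navier–Stokes regularity; no stub is proved here.

The free linearised profile operator of the line at the trivial base,
`𝓛_(α,0) W = α (e₃ × W − DW[e₃ × y]) + ½ W + ½ DW[y] − ΔW` (`Theorems.KelvinGate.lerayLin α 0`), generates
the semigroup `e^{-s𝓛} F (y) = e^{-s/2} R_{−αs} (e^{(1 − e^{-s})Δ} F)(e^{-s/2} R_{αs} y)` (`R_θ` the rotation
about `e₃`): an Ornstein–Uhlenbeck evolution in similarity variables composed with the rotating frame.
Its building block is the CONJUGATION of a field `g : ℝ³ → ℝ³` by the rotation–dilation `c R_θ`,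

  `(c • R_{−θ}) (g ((c • R_θ) y))`,

and this file records its first-order calculus, in the crux's pointwise vocabulary (`fderiv`, `Δ`,
`rotGen = e₃ × ·`):

* `rotZL_eq_rodrigues`, `hasDerivAt_rotZL` — Rodrigues' formula `R_θ = 1 + sin θ J + (1 − cos θ) J²`
  (`J = rotGenL`) and `d/dθ R_θ = J R_θ` as an identity of continuous linear maps;
* `hasDerivAt_exp_smul_rotZL` — `d/ds (e^{-s/2} R_{as}) = −½ e^{-s/2} R_{as} + a J (e^{-s/2} R_{as})`;
* `norm_smul_rotZL_apply`, `opNorm_smul_rotZL_le` — `‖(c • R_θ) v‖ = |c| ‖v‖`;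
* `hasFDerivAt_conj`, `fderiv_conj_apply_self`, `rotGen_conj_sub_fderiv_conj`, `laplacian_conj` —
  `D`, the transport term `DW[y]`, the rotation term `e₃ × W − DW[e₃ × y]` and `Δ` of the conjugated
  field in terms of those of `g` at `x = c R_θ y`;
* `lerayLin_zero_conj` — hence
  `𝓛_(α,0) (conj g)(y) = (c • R_{−θ}) (α(e₃ × g − Dg[e₃ × x]) + ½ g + ½ Dg[x] − c² Δg)(x)`:
  the free operator commutes with the conjugation up to the factor `c²` on the Laplacian — the
  algebraic identity behind `∂_s e^{-s𝓛}F = −𝓛 e^{-s𝓛}F` (next file of the line).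
-/

set_option linter.dupNamespace false

noncomputable section

namespace Summit.NavierStokesRegularity.NavierStokesRegularity.Theorems.KelvinGate

open Set Function Filter Topology InnerProductSpace
open Literature.Analysis.FluidPDE
open scoped Laplacian RealInnerProductSpace ContDiff Topology

/-! ## Rodrigues' formula and the derivative of the rotation group -/

/-- `J³ = −J` for the rotation generator `J v = e₃ × v = (−v₁, v₀, 0)`. -/
theorem rotGenL_comp_rotGenL_comp_rotGenL :
    rotGenL.comp (rotGenL.comp rotGenL) = -rotGenL := by
  ext v i
  fin_cases i <;> simp [rotGen]

/-- **Rodrigues' formula** for the rotations about `e₃`: `R_θ = 1 + sin θ · J + (1 − cos θ) · J²`. -/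
theorem rotZL_eq_rodrigues (θ : ℝ) :
    rotZL θ = 1 + Real.sin θ • rotGenL + (1 - Real.cos θ) • rotGenL.comp rotGenL := by
  ext v i
  fin_cases i <;> simp [rotGen] <;> ring

/-- The generator commutes with the rotations: `J R_θ = R_θ J`. -/
theorem rotGenL_comp_rotZL (θ : ℝ) : rotGenL.comp (rotZL θ) = (rotZL θ).comp rotGenL := by
  ext1 v
  simp only [ContinuousLinearMap.comp_apply, rotGenL_apply, rotZL_apply]
  exact rotGen_rotZ θ v

/-- `R_{−θ} R_θ = 1`. -/
theorem rotZL_neg_comp (θ : ℝ) : (rotZL (-θ)).comp (rotZL θ) = 1 := by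
  have h := rotZL_comp_neg (-θ)
  rw [neg_neg] at h
  exact h

/-- `R_{−θ} (R_θ v) = v`. -/
theorem rotZL_neg_apply_rotZL (θ : ℝ) (v : EuclideanSpace ℝ (Fin 3)) : rotZL (-θ) (rotZL θ v) = v := by
  have h := congrArg (fun L : EuclideanSpace ℝ (Fin 3) →L[ℝ] EuclideanSpace ℝ (Fin 3) => L v) (rotZL_neg_comp θ)
  simpa using h

/-- **`d/dθ R_θ = J R_θ`** as continuous linear maps (from Rodrigues' formula). -/
theorem hasDerivAt_rotZL (θ : ℝ) :
    HasDerivAt (fun t : ℝ => rotZL t) (rotGenL.comp (rotZL θ)) θ := by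
  have hfun : (fun t : ℝ => rotZL t) =
      fun t => 1 + Real.sin t • rotGenL + (1 - Real.cos t) • rotGenL.comp rotGenL :=
    funext rotZL_eq_rodrigues
  rw [hfun]
  have h1 : HasDerivAt (fun t : ℝ => Real.sin t • rotGenL) (Real.cos θ • rotGenL) θ :=
    (Real.hasDerivAt_sin θ).smul_const rotGenL
  have h2 : HasDerivAt (fun t : ℝ => (1 - Real.cos t) • rotGenL.comp rotGenL)
      (Real.sin θ • rotGenL.comp rotGenL) θ := by
    have := ((hasDerivAt_const θ (1:ℝ)).fun_sub (Real.hasDerivAt_cos θ)).smul_const (rotGenL.comp rotGenL)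
    simpa using this
  have h : HasDerivAt (fun t : ℝ => 1 + Real.sin t • rotGenL + (1 - Real.cos t) • rotGenL.comp rotGenL)
      (0 + Real.cos θ • rotGenL + Real.sin θ • rotGenL.comp rotGenL) θ :=
    ((hasDerivAt_const θ _).fun_add h1).fun_add h2
  refine h.congr_deriv ?_
  -- `cos θ J + sin θ J² = J (1 + sin θ J + (1 − cos θ) J²)` by `J³ = −J`
  rw [zero_add, rotZL_eq_rodrigues, ContinuousLinearMap.comp_add, ContinuousLinearMap.comp_add,
    ContinuousLinearMap.comp_smul, ContinuousLinearMap.comp_smul, rotGenL_comp_rotGenL_comp_rotGenL,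
    ContinuousLinearMap.one_def, ContinuousLinearMap.comp_id]
  module

/-- **Derivative of the dilation–rotation family** `L_s = e^{-s/2} R_{as}`:
`d/ds L_s = −½ L_s + a · J L_s`. -/
theorem hasDerivAt_exp_smul_rotZL (a s : ℝ) :
    HasDerivAt (fun t : ℝ => Real.exp (-(t / 2)) • rotZL (a * t))
      (-(1/2:ℝ) • (Real.exp (-(s / 2)) • rotZL (a * s)) +
        a • rotGenL.comp (Real.exp (-(s / 2)) • rotZL (a * s))) s := by
  have he : HasDerivAt (fun t : ℝ => Real.exp (-(t / 2))) (Real.exp (-(s / 2)) * (-(1/2:ℝ))) s := by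
    have h := ((hasDerivAt_id s).div_const 2).fun_neg.exp
    simp only [id] at h
    convert h using 2
  have ha : HasDerivAt (fun t : ℝ => a * t) a s := by
    simpa using (hasDerivAt_id s).const_mul a
  have hR : HasDerivAt (fun t : ℝ => rotZL (a * t)) (a • rotGenL.comp (rotZL (a * s))) s :=
    (hasDerivAt_rotZL (a * s)).scomp s ha
  have h := he.fun_smul hR
  refine h.congr_deriv ?_
  rw [ContinuousLinearMap.comp_smul, smul_smul, smul_smul, smul_smul]
  rw [show a * Real.exp (-(s / 2)) = Real.exp (-(s / 2)) * a by ring,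
    show -(1/2:ℝ) * Real.exp (-(s / 2)) = Real.exp (-(s / 2)) * (-(1/2:ℝ)) by ring]
  abel

/-! ## Norms -/

/-- `‖R_θ v‖ = ‖v‖`. -/
theorem norm_rotZL_apply (θ : ℝ) (v : EuclideanSpace ℝ (Fin 3)) : ‖rotZL θ v‖ = ‖v‖ := by
  rw [rotZL_apply]; exact norm_rotZ θ v

/-- `‖(c • R_θ) v‖ = |c| ‖v‖`. -/
theorem norm_smul_rotZL_apply (c θ : ℝ) (v : EuclideanSpace ℝ (Fin 3)) :
    ‖(c • rotZL θ) v‖ = |c| * ‖v‖ := by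
  rw [smul_apply, norm_smul, Real.norm_eq_abs, norm_rotZL_apply]

/-- `‖c • R_θ‖ ≤ |c|` (operator norm). -/
theorem opNorm_smul_rotZL_le (c θ : ℝ) : ‖c • rotZL θ‖ ≤ |c| :=
  ContinuousLinearMap.opNorm_le_bound _ (abs_nonneg c) fun v => (norm_smul_rotZL_apply c θ v).le

/-! ## Calculus of the conjugation `y ↦ (c • R_{−θ}) (g ((c • R_θ) y))` -/

section Conj

variable {g : EuclideanSpace ℝ (Fin 3) → EuclideanSpace ℝ (Fin 3)} {c θ : ℝ}

/-- Chain rule: `D[(c R_{−θ}) g (c R_θ ·)](y) = (c R_{−θ}) ∘ Dg(c R_θ y) ∘ (c R_θ)`. -/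
theorem hasFDerivAt_conj {y : EuclideanSpace ℝ (Fin 3)} (hg : DifferentiableAt ℝ g ((c • rotZL θ) y)) :
    HasFDerivAt (fun z => (c • rotZL (-θ)) (g ((c • rotZL θ) z)))
      ((c • rotZL (-θ)).comp ((fderiv ℝ g ((c • rotZL θ) y)).comp (c • rotZL θ))) y :=
  (c • rotZL (-θ)).hasFDerivAt.comp y (hg.hasFDerivAt.comp y (c • rotZL θ).hasFDerivAt)

/-- The derivative of the conjugated field (everywhere-differentiable `g`). -/
theorem fderiv_conj (hg : Differentiable ℝ g) (y : EuclideanSpace ℝ (Fin 3)) :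
    fderiv ℝ (fun z => (c • rotZL (-θ)) (g ((c • rotZL θ) z))) y =
      (c • rotZL (-θ)).comp ((fderiv ℝ g ((c • rotZL θ) y)).comp (c • rotZL θ)) :=
  (hasFDerivAt_conj (hg _)).fderiv

/-- Size of the derivative: `‖D conj(y)‖ ≤ |c|² ‖Dg(c R_θ y)‖`. -/
theorem norm_fderiv_conj_le (hg : Differentiable ℝ g) (y : EuclideanSpace ℝ (Fin 3)) :
    ‖fderiv ℝ (fun z => (c • rotZL (-θ)) (g ((c • rotZL θ) z))) y‖ ≤
      |c| ^ 2 * ‖fderiv ℝ g ((c • rotZL θ) y)‖ := by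
  rw [fderiv_conj hg y]
  calc ‖(c • rotZL (-θ)).comp ((fderiv ℝ g ((c • rotZL θ) y)).comp (c • rotZL θ))‖
      ≤ ‖c • rotZL (-θ)‖ * ‖(fderiv ℝ g ((c • rotZL θ) y)).comp (c • rotZL θ)‖ :=
        ContinuousLinearMap.opNorm_comp_le _ _
    _ ≤ ‖c • rotZL (-θ)‖ * (‖fderiv ℝ g ((c • rotZL θ) y)‖ * ‖c • rotZL θ‖) :=
        mul_le_mul_of_nonneg_left (ContinuousLinearMap.opNorm_comp_le _ _) (norm_nonneg _)
    _ ≤ |c| * (‖fderiv ℝ g ((c • rotZL θ) y)‖ * |c|) := by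
        gcongr
        · exact opNorm_smul_rotZL_le c (-θ)
        · exact opNorm_smul_rotZL_le c θ
    _ = |c| ^ 2 * ‖fderiv ℝ g ((c • rotZL θ) y)‖ := by ring

/-- **Transport term**: `D conj(y)[y] = (c R_{−θ}) (Dg(x)[x])` at `x = c R_θ y`. -/
theorem fderiv_conj_apply_self (hg : Differentiable ℝ g) (y : EuclideanSpace ℝ (Fin 3)) :
    fderiv ℝ (fun z => (c • rotZL (-θ)) (g ((c • rotZL θ) z))) y y =
      (c • rotZL (-θ)) (fderiv ℝ g ((c • rotZL θ) y) ((c • rotZL θ) y)) := by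
  rw [fderiv_conj hg y]; rfl

/-- The generator commutes with `c R_θ`: `J ((c R_θ) v) = (c R_θ) (J v)`. -/
theorem rotGen_smul_rotZL_apply (c θ : ℝ) (v : EuclideanSpace ℝ (Fin 3)) :
    rotGen ((c • rotZL θ) v) = (c • rotZL θ) (rotGen v) := by
  simp only [smul_apply, rotZL_apply, rotGen_smul, rotGen_rotZ]

/-- **Rotation term**: `e₃ × conj(y) − D conj(y)[e₃ × y] = (c R_{−θ}) (e₃ × g(x) − Dg(x)[e₃ × x])`, `x = c R_θ y`. -/
theorem rotGen_conj_sub_fderiv_conj (hg : Differentiable ℝ g) (y : EuclideanSpace ℝ (Fin 3)) :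
    rotGen ((c • rotZL (-θ)) (g ((c • rotZL θ) y))) -
        fderiv ℝ (fun z => (c • rotZL (-θ)) (g ((c • rotZL θ) z))) y (rotGen y) =
      (c • rotZL (-θ)) (rotGen (g ((c • rotZL θ) y)) -
        fderiv ℝ g ((c • rotZL θ) y) (rotGen ((c • rotZL θ) y))) := by
  rw [fderiv_conj hg y, rotGen_smul_rotZL_apply, map_sub]
  simp only [ContinuousLinearMap.comp_apply, rotGen_smul_rotZL_apply]

/-- **Laplacian**: `Δ conj (y) = c³ R_{−θ} (Δg)(c R_θ y)` for `g ∈ C²` (rotation covariance of `Δ` and the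
dilation rule `Δ(c g(c ·)) = c³ (Δg)(c ·)`). -/
theorem laplacian_conj (hg : ContDiff ℝ 2 g) (y : EuclideanSpace ℝ (Fin 3)) :
    (Δ (fun z => (c • rotZL (-θ)) (g ((c • rotZL θ) z)))) y =
      (c ^ 3 • rotZL (-θ)) ((Δ g) ((c • rotZL θ) y)) := by
  -- `conj = R_{−θ} ∘ h ∘ R_θ` with `h = c g(c ·)`; the rotation conjugation is `laplacian_conj_linearIsometryEquiv`
  set h : EuclideanSpace ℝ (Fin 3) → EuclideanSpace ℝ (Fin 3) := fun z => c • g (c • z) with hh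
  have hfun : (fun z => (c • rotZL (-θ)) (g ((c • rotZL θ) z))) =
      fun z => (rotZLIE (-θ)) (h ((rotZLIE (-θ)).symm z)) := by
    funext z
    simp only [hh, smul_apply, rotZL_apply, rotZLIE_apply, rotZLIE_symm_apply, neg_neg,
      map_smul]
  rw [hfun, laplacian_conj_linearIsometryEquiv (rotZLIE (-θ)) h y]
  simp only [rotZLIE_symm_apply, neg_neg, hh]
  rw [laplacian_smul_comp_smul hg c]
  simp only [smul_apply, rotZL_apply, rotZLIE_apply, map_smul]

/-- **The free linearised profile operator on a conjugated field.**  For `g ∈ C²`, every rate `α` and `x = c R_θ y`: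
`𝓛_(α,0) (conj g)(y) = (c R_{−θ}) (α (e₃ × g(x) − Dg(x)[e₃ × x]) + ½ g(x) + ½ Dg(x)[x] − c² Δg(x))`. -/
theorem lerayLin_zero_conj (hg : ContDiff ℝ 2 g) (α : ℝ) (y : EuclideanSpace ℝ (Fin 3)) :
    lerayLin α (fun _ => 0) (fun z => (c • rotZL (-θ)) (g ((c • rotZL θ) z))) y =
      (c • rotZL (-θ)) (α • (rotGen (g ((c • rotZL θ) y)) - fderiv ℝ g ((c • rotZL θ) y) (rotGen ((c • rotZL θ) y)))
        + (1/2:ℝ) • g ((c • rotZL θ) y) + (1/2:ℝ) • fderiv ℝ g ((c • rotZL θ) y) ((c • rotZL θ) y)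
        - c ^ 2 • (Δ g) ((c • rotZL θ) y)) := by
  have hd : Differentiable ℝ g := hg.differentiable (by norm_num)
  unfold lerayLin
  rw [cross_single_two_eq_rotGen, cross_single_two_eq_rotGen, rotGen_conj_sub_fderiv_conj hd,
    fderiv_conj_apply_self hd, laplacian_conj hg]
  simp only [fderiv_fun_const, Pi.zero_apply, zero_apply, map_zero, add_zero,
    smul_apply, map_add, map_sub, map_smul, smul_sub]
  module

end Conj

end Summit.NavierStokesRegularity.NavierStokesRegularity.Theorems.KelvinGate

end
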